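import Summits.BirchSwinnertonDyer.BirchSwinnertonDyer.Theorems.SignedLowerHalvesSmallImageLowerHalfBothSignsRttD2SeqJ3Konig
import Summits.BirchSwinnertonDyer.BirchSwinnertonDyer.Theorems.SignedLowerHalvesSmallImageLowerHalfBothSignsRttD2J2Levelwise
import HarnessLib

/-!
# Route `SignedLowerHalves`, crux L `SmallImageLowerHalfBothSigns` (stmt-BirchSwinnertonDyer-23599), line `rtt_w3` v14 → v15 — E2, row J3
# (Galois side, part α‴): THE STRICT JUNCTION CARRIER `B'` AND THE JUNCTION `j₀ : B' →ₗ[Λ_𝒪] DQ.X` WITH `Function.Exact j₀ gX`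
# FROM A FINITE-LEVEL LAYER PAIRING AND ITS LAYERWISE POITOU–TATE INPUTS

WIDTH seat `bsd-line-slh-p3-w3` g22 under LEAD `cruxlead-stmt-BirchSwinnertonDyer-23599` g11 (cell `bsd-ssimc`; KEY 2026-08-30T18:56:57Z «J3 = `j₀` + `Function.Exact j₀ gX`»;
RULING (F1)/(F2) 19:25:38Z: junction carrier `B' = ker(B → Π_{S₀K} 𝐇¹_w)` ⊆ `B = (CycIwasawaCohomologyDataO … γK⁻¹ θ* … 1).H`, `ι : B' →ₗ B` injective, `j₀` on `B'`);
helper `--supports stmt-BirchSwinnertonDyer-23599`. ONE DEFINITION WITH BODY (`strictCarrier`) + THEOREMS; no named fact, no instance, no `sorry`.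
HONEST FRAMING: this ASSEMBLES J3 from the finite layers — the local Tate pairings of the layers (an inhabitant `𝓛` of the socket `LayerPairing`, part α′), their Poitou–Tate
identities AT THE LAYERS (`hrecL`: reciprocity for strict classes; `hsolL`: annihilator surjectivity on the diagonal layers `(m, m)`), the strict sets `Str` (kernels of
`loc_{S₀K}`) and the finiteness of the layer groups remain HYPOTHESES (part β); E2, crux L, crux M and BSD remain OPEN and are proved for NO curve.

* §1 ★ `strictCarrier I Str hStr : Submodule (IwasawaAlgebraO S) I.H` — `B' := {b | ∀ n k, proj_{n,k} b ∈ Str n k}` for a family of subgroups `Str n k ≤ G_{n,k}` stable under the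
  `Λ_𝒪`-action of the levels (honda's `cycLayerModuleO`; submodule by the rigidity `proj_smul_eq_cycLayer_smul`, p782360); `ι = B'.subtype` (injective, `Λ_𝒪`-linear).
* §2 `strictPairing` (`P` restricted to `B'`) with `hPX`/`hPC`, ★★ `strictPairing_locSat_eq_zero` (`hrec` on `B'` from the layers), ★★ `exists_strict_pairing_eq` (`hPT` on `B'`
  from the layers, part α″).
* §3 ★★★ `exists_junction_exact_of_layerPairing`: `∃ j₀ : B' →ₗ[Λ_𝒪] DQ.X, DQ.toDual ∘ j₀ = P ∧ Function.Exact j₀ gX` — -w3 g21's `exists_junction_exact` (p782881) fed with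
  `P := (𝓛.towerPairing I).pairing|_{B'}` and the four laws — i.e. the binders `j₀`/`hexact` of the LEAD's depleted junction consumer ON `B'`, modulo the finite-level inputs.
References: [Kobayashi2003] Thm. 7.3 i); [Rubin2000] Thm. 1.7.3, Prop. B.1.1; [Kato2004Asterisque] §8.2, §17.13; [MilneADT2006] I Thm. 4.10; [Washington1997] §13.2.
-/

set_option autoImplicit false
set_option linter.dupNamespace false -- D-0017: single-problem summit, the namespace repeats the problem name by design
noncomputable section

open scoped Classical
open NumberField IsDedekindDomain Field

namespace Summit.BirchSwinnertonDyer.BirchSwinnertonDyer.Theorems.SmallImageRttD2Seq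

open Literature.NumberTheory.EllipticCurves Literature.NumberTheory.EllipticCurves.Kobayashi2003
  Literature.NumberTheory.EllipticCurves.GreenbergVatsal2000 Literature.NumberTheory.GaloisRepresentations
  Summit.BirchSwinnertonDyer.BirchSwinnertonDyer.Theorems.SmallImageCharSignedSelmer
  Summit.BirchSwinnertonDyer.BirchSwinnertonDyer.Theorems.SmallImageRttD2J1
  Summit.BirchSwinnertonDyer.BirchSwinnertonDyer.Theorems.SmallImageRttD2J2

/-! ## §1. The strict junction carrier `B'` -/

section Strict

variable {K : Type} [Field K] [NumberField K] {p : ℕ} [Fact p.Prime] {κ : ZpExtension K p} {S : Set (PadicAlgCl p)}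
  {γB : absoluteGaloisGroup K} {θ' : absoluteGaloisGroup K →ₜ* (padicCoeffIntegers S)ˣ} {P : Set (HeightOneSpectrum (𝓞 K))}
  (I : CycIwasawaCohomologyDataO S κ γB θ' P 1) (Str : ∀ n k : ℕ, AddSubgroup (cycLayerCohO S κ θ' P n k 1))
  (hStr : ∀ (n k : ℕ) (f : IwasawaAlgebraO S) (y : cycLayerCohO S κ θ' P n k 1), y ∈ Str n k →
    (letI := cycLayerModuleO S κ γB θ' P (show 1 ≤ 2 by norm_num) n k; f • y) ∈ Str n k)

/-- ★ **The strict junction carrier `B' = {b ∈ B | proj_{n,k} b ∈ Str n k ∀ n k}`** (RULING (F1): intended `Str n k = ker(loc_{S₀K})` at level `(n, k)`, so that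
`B' = ker(B → Π_{w ∈ S₀K} 𝐇¹(K_{∞,w}, T*))`), a `Λ_𝒪`-SUBMODULE of honda's `B = I.H`: the levels are `Λ_𝒪`-modules (`cycLayerModuleO`) with `proj (f • b) = f • proj b`
(rigidity of the pins, p782360), and the `Str n k` are `Λ_𝒪`-stable. Its inclusion `ι = B'.subtype` is the injective `Λ_𝒪`-linear map of the LEAD's depleted junction.
[cite: Rubin2000, Thm. 1.7.3] [cite: Kato2004Asterisque, §8.2 (p. 180)] -/
def strictCarrier : Submodule (IwasawaAlgebraO S) I.H where
  carrier := {b | ∀ n k : ℕ, I.proj n k b ∈ Str n k}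
  zero_mem' := fun n k ↦ by rw [map_zero]; exact zero_mem _
  add_mem' := fun {b b'} hb hb' n k ↦ by rw [map_add]; exact add_mem (hb n k) (hb' n k)
  smul_mem' := fun f b hb n k ↦ by
    change I.proj n k (f • b) ∈ Str n k
    rw [proj_smul_eq_cycLayer_smul (show 1 ≤ 2 by norm_num) I n k f b]
    exact hStr n k f _ (hb n k)

/-- Membership in `B'`. [cite: Rubin2000, Thm. 1.7.3] -/
theorem mem_strictCarrier_iff (b : I.H) : b ∈ strictCarrier I Str hStr ↔ ∀ n k : ℕ, I.proj n k b ∈ Str n k := Iff.rfl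

end Strict

/-! ## §2. The pairing on `B'` and its four laws from the layers -/

section Pairing

variable {K : Type} [Field K] [NumberField K] {p : ℕ} [Fact p.Prime] {κ : ZpExtension K p} {S : Set (PadicAlgCl p)}
  {M : Type} [AddCommGroup M] [TopologicalSpace M] [DiscreteTopology M] [Module (padicCoeffIntegers S) M]
  {V : WeierstrassCurve K} {j : V.geomPrimaryTorsion p →+ M} {S₀ : Set (HeightOneSpectrum (𝓞 K))} {ε : ℤˣ}
  {v : HeightOneSpectrum (𝓞 K)} [DistribMulAction (absoluteGaloisGroup (v.adicCompletion K)) M]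
  [SMulCommClass (absoluteGaloisGroup (v.adicCompletion K)) (padicCoeffIntegers S) M]
  {γv : absoluteGaloisGroup (v.adicCompletion K)}
  {γB : absoluteGaloisGroup K} {θ' : absoluteGaloisGroup K →ₜ* (padicCoeffIntegers S)ˣ} {P : Set (HeightOneSpectrum (𝓞 K))}
  (𝓛 : LayerPairing S M γv κ γB θ' P) (I : CycIwasawaCohomologyDataO S κ γB θ' P 1) (Str : ∀ n k : ℕ, AddSubgroup (cycLayerCohO S κ θ' P n k 1))
  (hStr : ∀ (n k : ℕ) (f : IwasawaAlgebraO S) (y : cycLayerCohO S κ θ' P n k 1), y ∈ Str n k →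
    (letI := cycLayerModuleO S κ γB θ' P (show 1 ≤ 2 by norm_num) n k; f • y) ∈ Str n k)
  (hstab : ∀ m : M, IsOpen (MulAction.stabilizer (absoluteGaloisGroup (v.adicCompletion K)) m : Set (absoluteGaloisGroup (v.adicCompletion K))))

/-- **`P|_{B'} : B' →+ Hom(E^{ε}_{sat,v}, ℚ/ℤ)`**, the junction pairing of parts α/α′ restricted to the strict carrier. [cite: Kobayashi2003, Thm. 7.3 i)] -/
def strictPairing : strictCarrier I Str hStr →+ (localCondInftySat κ M (padicCoeffIntegers S) V j ε v →+ AddCircle (1 : ℚ)) :=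
  ((𝓛.towerPairing I).pairing hstab).comp (strictCarrier I Str hStr).subtype.toAddMonoidHom

/-- Unfolding `strictPairing`. [cite: Kobayashi2003, Thm. 7.3 i)] -/
@[simp] theorem strictPairing_apply (b : strictCarrier I Str hStr) (c : localCondInftySat κ M (padicCoeffIntegers S) V j ε v) :
    strictPairing 𝓛 I Str hStr hstab b c = (𝓛.towerPairing I).pairing hstab (b : I.H) c :=
  rfl

/-- **`hPX` on `B'`.** [cite: Kato2004Asterisque, §17.13] -/
theorem strictPairing_X_smul (b : strictCarrier I Str hStr) (c : localCondInftySat κ M (padicCoeffIntegers S) V j ε v) :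
    strictPairing 𝓛 I Str hStr hstab ((PowerSeries.X : IwasawaAlgebraO S) • b) c =
      strictPairing 𝓛 I Str hStr hstab b ((conjLocalSat κ M (padicCoeffIntegers S) V j ε v γv - 1) c) := by
  rw [strictPairing_apply, strictPairing_apply, Submodule.coe_smul, TowerPairing.pairing_X_smul]

/-- **`hPC` on `B'`.** [cite: Kato2004Asterisque, §17.13] -/
theorem strictPairing_C_smul (a : padicCoeffIntegers S) (b : strictCarrier I Str hStr) (c : localCondInftySat κ M (padicCoeffIntegers S) V j ε v) :
    strictPairing 𝓛 I Str hStr hstab ((PowerSeries.C a : IwasawaAlgebraO S) • b) c =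
      strictPairing 𝓛 I Str hStr hstab b (scalarLocalSat κ M (padicCoeffIntegers S) V j ε v a c) := by
  rw [strictPairing_apply, strictPairing_apply, Submodule.coe_smul, TowerPairing.pairing_C_smul]

variable [DistribMulAction (absoluteGaloisGroup K) M]
  (hres : ∀ (σ : absoluteGaloisGroup (v.adicCompletion K)) (m : M), σ • m = resGalOfEmb (closureEmb (K := K) (v.adicCompletion K)) σ • m)
  (hvp : (p : 𝓞 K) ∈ v.asIdeal)

/-- ★★ **`hrec` on `B'` from the layers**: if at every layer `K_n` the layer pairing of a STRICT `b` with the localisation of every class of `Sel^{ε,S₀}_𝒪(K_n, M)` vanishes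
(Poitou–Tate's sum formula at `K_n`: the terms at `w ∈ S₀K` die because `b` is strict there, the others by the local conditions), then `P b` kills `loc_v(Sel^{ε,S₀}_𝒪(K_∞, M))`.
[cite: Rubin2000, Thm. 1.7.3] [cite: MilneADT2006, I Thm. 4.10] -/
theorem strictPairing_locSat_eq_zero
    (hrecL : ∀ (n : ℕ) (b : I.H), (∀ n k : ℕ, I.proj n k b ∈ Str n k) → ∀ c : subgroupH1 (κ.layerSubgroup n) M,
      c ∈ signedTransportSelmerLayerSat κ M (padicCoeffIntegers S) V j S₀ ε n → 𝓛.pairLayer n b (locH1Layer κ M v hres n c) = 0)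
    (b : strictCarrier I Str hStr) (s : signedTransportSelmerInftySat κ M (padicCoeffIntegers S) V j S₀ ε) :
    strictPairing 𝓛 I Str hStr hstab b (locSat κ M (padicCoeffIntegers S) V j S₀ ε v hres hvp s) = 0 := by
  rw [strictPairing_apply, TowerPairing.pairing_apply, coe_locSat_apply]
  refine AddSubgroup.iSup_induction (fun n ↦ (signedTransportSelmerLayerSat κ M (padicCoeffIntegers S) V j S₀ ε n).map (resOfLe M (κ.kerSubgroup_le_layerSubgroup n)))
    (C := fun s ↦ (𝓛.towerPairing I).pairInf hstab (b : I.H) (locH1 κ M v hres s) = 0) s.2 ?_ ?_ ?_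
  · rintro n s ⟨c, hc, rfl⟩
    have hcomm := DFunLike.congr_fun (resOfLe_comp_locH1Layer κ M v hres n) c
    simp only [AddMonoidHom.comp_apply] at hcomm
    rw [← hcomm, TowerPairing.pairInf_apply_resOfLe, LayerPairing.towerPairing_pairL]
    exact hrecL n b b.2 c hc
  · rw [map_zero, map_zero]
  · intro s t hs ht
    rw [map_add, map_add, hs, ht, add_zero]

/-- ★★ **`hPT` on `B'` from the layers** (part α″ repackaged): every character of `E^{ε}_{sat,v}` killing `loc_v(Sel)` is `P b` for a STRICT `b`, granted diagonal layerwise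
strict solutions (`hsolL`, Poitou–Tate at the layers `(m, m)`), transition-closed strict sets, finite layer groups and a good exhausting family.
[cite: Rubin2000, Thm. 1.7.3, Prop. B.1.1] [cite: MilneADT2006, I Thm. 4.10] -/
theorem exists_strictPairing_eq (hfin : ∀ n k : ℕ, Finite (cycLayerCohO S κ θ' P n k 1))
    (hStrLE : ∀ {n n' : ℕ} (hn : n ≤ n') {k k' : ℕ} (hk : k ≤ k') (y : cycLayerCohO S κ θ' P n' k' 1), y ∈ Str n' k' → 𝓛.coresLE hn k (𝓛.redLE n' hk y) ∈ Str n k)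
    (Good : ∀ n k : ℕ, Set (𝓛.L n k))
    (hgoodE : ∀ (n k : ℕ) (ℓ : 𝓛.L n k), ℓ ∈ Good n k →
      resOfLe M (localSubgroupOfEmb_kerSubgroup_le κ v n) (𝓛.toH1 n k ℓ) ∈ localCondInftySat κ M (padicCoeffIntegers S) V j ε v)
    (hgood : ∀ c : localCondInftySat κ M (padicCoeffIntegers S) V j ε v, ∃ (n k : ℕ) (ℓ : 𝓛.L n k), ℓ ∈ Good n k ∧
      resOfLe M (localSubgroupOfEmb_kerSubgroup_le κ v n) (𝓛.toH1 n k ℓ) = c)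
    (hgood_mono : ∀ {n n' : ℕ} (hn : n ≤ n') {k k' : ℕ} (hk : k ≤ k') (ℓ : 𝓛.L n k), ℓ ∈ Good n k → 𝓛.inclLE n' hk (𝓛.resLE hn k ℓ) ∈ Good n' k')
    (hsolL : ∀ q : localCondInftySat κ M (padicCoeffIntegers S) V j ε v →+ AddCircle (1 : ℚ),
      (∀ s : signedTransportSelmerInftySat κ M (padicCoeffIntegers S) V j S₀ ε, q (locSat κ M (padicCoeffIntegers S) V j S₀ ε v hres hvp s) = 0) →
      ∀ m : ℕ, ∃ y ∈ Str m m, ∀ (ℓ : 𝓛.L m m) (hℓ : ℓ ∈ Good m m), 𝓛.pairNK m m y ℓ = q ⟨_, hgoodE m m ℓ hℓ⟩)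
    (q : localCondInftySat κ M (padicCoeffIntegers S) V j ε v →+ AddCircle (1 : ℚ))
    (hq : ∀ s : signedTransportSelmerInftySat κ M (padicCoeffIntegers S) V j S₀ ε, q (locSat κ M (padicCoeffIntegers S) V j S₀ ε v hres hvp s) = 0) :
    ∃ b : strictCarrier I Str hStr, strictPairing 𝓛 I Str hStr hstab b = q := by
  obtain ⟨b, hb, hbq⟩ := 𝓛.exists_proj_mem_and_pairing_eq (I := I) hstab hfin (fun n k ↦ (Str n k : Set (cycLayerCohO S κ θ' P n k 1)))
    (fun {n n'} hn {k k'} hk y hy ↦ hStrLE hn hk y hy) Good hgoodE hgood hgood_mono q (hsolL q hq)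
  exact ⟨⟨b, hb⟩, AddMonoidHom.ext fun c ↦ hbq c⟩

end Pairing

/-! ## §3. The junction `j₀ : B' →ₗ[Λ_𝒪] DQ.X` with `Function.Exact j₀ gX` -/

section Junction

variable {K : Type} [Field K] [NumberField K] {p : ℕ} [Fact p.Prime] {κ : ZpExtension K p} {γ : absoluteGaloisGroup K}
  (S : Set (PadicAlgCl p)) [FiniteDimensional ℚ_[p] (padicCoeffField S)]
  {M : Type} [AddCommGroup M] [DistribMulAction (absoluteGaloisGroup K) M] [TopologicalSpace M] [DiscreteTopology M]
  [Module (padicCoeffIntegers S) M] [SMulCommClass (absoluteGaloisGroup K) (padicCoeffIntegers S) M]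
  {V : WeierstrassCurve K} {j : V.geomPrimaryTorsion p →+ M} {S₀ : Set (HeightOneSpectrum (𝓞 K))} {ε : ℤˣ}
  (D : SignedTransportDualDataSat κ γ M (padicCoeffIntegers S) V j S₀ ε)
  {v : HeightOneSpectrum (𝓞 K)} [DistribMulAction (absoluteGaloisGroup (v.adicCompletion K)) M]
  [SMulCommClass (absoluteGaloisGroup (v.adicCompletion K)) (padicCoeffIntegers S) M]
  {γv : absoluteGaloisGroup (v.adicCompletion K)} (DQ : LocalCondDualData κ M (padicCoeffIntegers S) V j ε v γv)
  (hres : ∀ (σ : absoluteGaloisGroup (v.adicCompletion K)) (m : M), σ • m = resGalOfEmb (closureEmb (K := K) (v.adicCompletion K)) σ • m)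
  (hvp : (p : 𝓞 K) ∈ v.asIdeal)
  {γB : absoluteGaloisGroup K} {θ' : absoluteGaloisGroup K →ₜ* (padicCoeffIntegers S)ˣ} {P : Set (HeightOneSpectrum (𝓞 K))}
  (𝓛 : LayerPairing S M γv κ γB θ' P) (I : CycIwasawaCohomologyDataO S κ γB θ' P 1) (Str : ∀ n k : ℕ, AddSubgroup (cycLayerCohO S κ θ' P n k 1))
  (hStr : ∀ (n k : ℕ) (f : IwasawaAlgebraO S) (y : cycLayerCohO S κ θ' P n k 1), y ∈ Str n k →
    (letI := cycLayerModuleO S κ γB θ' P (show 1 ≤ 2 by norm_num) n k; f • y) ∈ Str n k)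

/-- ★★★ **J3 ASSEMBLED FROM THE FINITE LAYERS.** For honda's pinned datum `I` (generator `γ_B` with `κ(γ_B) = −κ(res_ι γ_v)`, RULING (F2)), a finite-level layer pairing `𝓛`
(socket `LayerPairing`: the local Tate pairings `H¹(G_P(K_n), T*/p^k) × H¹(K_{n,v}, M[p^k]) → ℚ/ℤ` with their four adjointness laws), `Λ_𝒪`-stable transition-closed strict
subgroups `Str n k` (RULING (F1): `ker loc_{S₀K}`), finite layer groups, a good exhausting family of finite-level local classes, and the two LAYERWISE Poitou–Tate inputs —
`hrecL` (reciprocity: a strict class pairs to zero with `loc_{v,n}(Sel^{ε,S₀}_𝒪(K_n, M))`) and `hsolL` (annihilator surjectivity at the diagonal layers) — there is a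
`Λ_𝒪`-LINEAR `j₀ : B' →ₗ DQ.X` on the strict carrier `B' = strictCarrier I Str` with `DQ.toDual ∘ j₀ = P|_{B'}` and `Function.Exact j₀ gX` (`gX = loc_v^∨`): the binders
`j₀`/`hexact` of the LEAD's depleted junction consumer, by -w3 g21's `exists_junction_exact` (p782881). [cite: Kobayashi2003, Thm. 7.3 i)] [cite: Rubin2000, Thm. 1.7.3]
[cite: Kato2004Asterisque, §17.13] [cite: Washington1997, §13.2] -/
theorem exists_junction_exact_of_layerPairing (instX : Module (IwasawaAlgebraO S) D.X) (instQ : Module (IwasawaAlgebraO S) DQ.X)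
    (hιX : ∀ (f : IwasawaAlgebra p) (x : D.X), (letI := instX; iwasawaToIwasawaO S f • x) = f • x)
    (hιQ : ∀ (f : IwasawaAlgebra p) (x : DQ.X), (letI := instQ; iwasawaToIwasawaO S f • x) = f • x)
    (hCX : ∀ (a : padicCoeffIntegers S) (x : D.X) (s : signedTransportSelmerInftySat κ M (padicCoeffIntegers S) V j S₀ ε),
      D.toDual (letI := instX; (PowerSeries.C a : IwasawaAlgebraO S) • x) s =
        D.toDual x ⟨GreenbergSelmer.scalarH1 κ.kerSubgroup M a s, scalarH1_mem_signedTransportSelmerInftySat κ M (padicCoeffIntegers S) V j S₀ ε a s.2⟩)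
    (hCQ : ∀ (a : padicCoeffIntegers S) (x : DQ.X) (c : localCondInftySat κ M (padicCoeffIntegers S) V j ε v),
      DQ.toDual (letI := instQ; (PowerSeries.C a : IwasawaAlgebraO S) • x) c = DQ.toDual x (scalarLocalSat κ M (padicCoeffIntegers S) V j ε v a c))
    (htor : ∀ m : M, ∃ k : ℕ, p ^ k • m = 0)
    (hstabK : ∀ m : M, IsOpen (MulAction.stabilizer (absoluteGaloisGroup K) m : Set (absoluteGaloisGroup K)))
    (hstab : ∀ m : M, IsOpen (MulAction.stabilizer (absoluteGaloisGroup (v.adicCompletion K)) m : Set (absoluteGaloisGroup (v.adicCompletion K))))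
    (hγ : κ.IsTopGenerator γ) (hv : AcSigned.IsNonsplitIn κ v) (hγv : κ.IsTopGenerator (resGalOfEmb (closureEmb (K := K) (v.adicCompletion K)) γv))
    (hfin : ∀ n k : ℕ, Finite (cycLayerCohO S κ θ' P n k 1))
    (hStrLE : ∀ {n n' : ℕ} (hn : n ≤ n') {k k' : ℕ} (hk : k ≤ k') (y : cycLayerCohO S κ θ' P n' k' 1), y ∈ Str n' k' → 𝓛.coresLE hn k (𝓛.redLE n' hk y) ∈ Str n k)
    (Good : ∀ n k : ℕ, Set (𝓛.L n k))
    (hgoodE : ∀ (n k : ℕ) (ℓ : 𝓛.L n k), ℓ ∈ Good n k →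
      resOfLe M (localSubgroupOfEmb_kerSubgroup_le κ v n) (𝓛.toH1 n k ℓ) ∈ localCondInftySat κ M (padicCoeffIntegers S) V j ε v)
    (hgood : ∀ c : localCondInftySat κ M (padicCoeffIntegers S) V j ε v, ∃ (n k : ℕ) (ℓ : 𝓛.L n k), ℓ ∈ Good n k ∧
      resOfLe M (localSubgroupOfEmb_kerSubgroup_le κ v n) (𝓛.toH1 n k ℓ) = c)
    (hgood_mono : ∀ {n n' : ℕ} (hn : n ≤ n') {k k' : ℕ} (hk : k ≤ k') (ℓ : 𝓛.L n k), ℓ ∈ Good n k → 𝓛.inclLE n' hk (𝓛.resLE hn k ℓ) ∈ Good n' k')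
    (hrecL : ∀ (n : ℕ) (b : I.H), (∀ n k : ℕ, I.proj n k b ∈ Str n k) → ∀ c : subgroupH1 (κ.layerSubgroup n) M,
      c ∈ signedTransportSelmerLayerSat κ M (padicCoeffIntegers S) V j S₀ ε n → 𝓛.pairLayer n b (locH1Layer κ M v hres n c) = 0)
    (hsolL : ∀ q : localCondInftySat κ M (padicCoeffIntegers S) V j ε v →+ AddCircle (1 : ℚ),
      (∀ s : signedTransportSelmerInftySat κ M (padicCoeffIntegers S) V j S₀ ε, q (locSat κ M (padicCoeffIntegers S) V j S₀ ε v hres hvp s) = 0) →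
      ∀ m : ℕ, ∃ y ∈ Str m m, ∀ (ℓ : 𝓛.L m m) (hℓ : ℓ ∈ Good m m), 𝓛.pairNK m m y ℓ = q ⟨_, hgoodE m m ℓ hℓ⟩) :
    letI := instX; letI := instQ
    ∃ j₀ : strictCarrier I Str hStr →ₗ[IwasawaAlgebraO S] DQ.X, (∀ b : strictCarrier I Str hStr, DQ.toDual (j₀ b) = strictPairing 𝓛 I Str hStr hstab b) ∧
      Function.Exact j₀ (gXLinearMapO S D DQ hres hvp instX instQ hιX hιQ hCX hCQ htor hstabK hstab hγ hv hγv) :=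
  exists_junction_exact S D DQ hres hvp (strictPairing 𝓛 I Str hStr hstab) instX instQ hιX hιQ hCX hCQ htor hstabK hstab hγ hv hγv
    (strictPairing_locSat_eq_zero 𝓛 I Str hStr hstab hres hvp hrecL) (strictPairing_X_smul 𝓛 I Str hStr hstab) (strictPairing_C_smul 𝓛 I Str hStr hstab)
    (fun q hq ↦ exists_strictPairing_eq 𝓛 I Str hStr hstab hres hvp hfin hStrLE Good hgoodE hgood hgood_mono hsolL q hq)

end Junction

end Summit.BirchSwinnertonDyer.BirchSwinnertonDyer.Theorems.SmallImageRttD2Seq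

end
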